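import Mathlib
import HarnessLib
import Summits.AtomisticToContinuum.FouriersLaw.Theorems.JunctionLocalityConductanceLowerBoundStubShortTimeDipoleFloorAux5
import Summits.AtomisticToContinuum.FouriersLaw.Theorems.JunctionLocalityConductanceLowerBoundStubShortTimeDipoleFloorAux8
import Summits.AtomisticToContinuum.FouriersLaw.Theorems.JunctionLocalityConductanceLowerBoundStubShortTimeDipoleFloorAux9

/-!
# Short-time dipole floor, helper 12: second moments of the local light-cone sums under Gibbs ⊗ Wiener

Helper (`--supports stmt-AtomisticToContinuum-11749`) for stub `stub_shortTimeDipoleFloor` (S) of line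
`kick-dipole-no-collapse`, crux `JunctionLocality.ConductanceLowerBound`.

The pathwise local light cone (helper 7) bounds the deviation of the two synchronously coupled flows at a site `k` by
`2|p_0| Σ_{n ≥ k} (s^n/n!) 3^n S_n`, `S_n = Σ_{l ≤ n} (C₁ Θ_l)^n`, with the LOCAL weights
`Θ_l = Σ_{|m−l|≤1} θ_m`, `θ_m = 1 + (2q_m² + 2t∫₀ᵗ p_m(Φ_r x)²) + (2q_m² + 2t∫₀ᵗ p_m(Φ_r x^0)²)`.  This file bounds the SECOND
MOMENTS of the random coefficients `S_n` under the stationary law `π = μ_T ⊗ W`, uniformly in `N`, with factorial growth in `n`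
(window `t ∈ [0, 1]`):

* `lintegral_siteWeight_pow_le_of_moments` — `∫⁻ θ_m^k dπ ≤ 5C (10 A₁ k)^k` (`k ≥ 1`; helper 9 fed with the factorial Gibbs
  moments `∫ q^{2k}, ∫ p^{2k} ≤ C (A k)^k` of helper 8, `A₁ = max A 1`);
* `lintegral_localWeight_pow_le` — `∫⁻ Θ_l^k dπ ≤ 15 C (30 A₁ k)^k` (power mean over the at most three neighbours);
* `lintegral_coneSum_sq_le` — `∫⁻ S_n² dπ ≤ 15 C ((n+1)² (60 C₁ A₁ n)^n)²` (`n ≥ 1`; power mean over the `n + 1` sites of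
  the ball, `Θ`-moments of order `2n`);
* `helper_kdConeSumMoments` — the registered closed form (constants from helper 8 inlined as an `∃`).
-/

noncomputable section

open MeasureTheory ProbabilityTheory Set Filter Topology Finset
open scoped NNReal ENNReal

namespace Summit.AtomisticToContinuum.FouriersLaw.Cruxes.ConductanceLowerBound.KickDipoleNoCollapse

open Literature.MathematicalPhysics.KineticTheory Literature.MathematicalPhysics.KineticTheory.HeatConduction
open Literature.Probability.Process OscillatorChain
open Summit.AtomisticToContinuum.FouriersLaw.Theorems
open Summit.AtomisticToContinuum.FouriersLaw.Theorems.NonBallistic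

/-! ### Elementary sums over neighbourhoods and balls -/

/-- Sums over the (at most three) lattice neighbours of a site, `ℝ≥0∞` version of `sum_nbr_le`. -/
theorem sum_nbr_le_ennreal {N : ℕ} (k : Fin N) {a : Fin N → ℝ≥0∞} {A : ℝ≥0∞}
    (ha : ∀ l : Fin N, l.val ≤ k.val + 1 ∧ k.val ≤ l.val + 1 → a l ≤ A) :
    (∑ l : Fin N, if l.val ≤ k.val + 1 ∧ k.val ≤ l.val + 1 then a l else 0) ≤ 3 * A := by
  rw [← Finset.sum_filter]
  calc ∑ l ∈ univ.filter (fun l : Fin N => l.val ≤ k.val + 1 ∧ k.val ≤ l.val + 1), a l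
      ≤ ∑ _l ∈ univ.filter (fun l : Fin N => l.val ≤ k.val + 1 ∧ k.val ≤ l.val + 1), A :=
        Finset.sum_le_sum fun l hl => ha l (by simpa using hl)
    _ = ((univ.filter fun l : Fin N => l.val ≤ k.val + 1 ∧ k.val ≤ l.val + 1).card : ℝ≥0∞) * A := by
        rw [Finset.sum_const, nsmul_eq_mul]
    _ ≤ 3 * A := by
        gcongr
        exact_mod_cast card_filter_nbr_le_three k

/-- Power mean over the (at most three) lattice neighbours: `(Σ_{|l−k|≤1} θ_l)^n ≤ 3^n Σ_{|l−k|≤1} θ_l^n` for `θ ≥ 0`. -/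
theorem pow_nbrSum_le {N : ℕ} (k : Fin N) {θ : Fin N → ℝ} (hθ : ∀ l, 0 ≤ θ l) (n : ℕ) :
    (∑ l : Fin N, if l.val ≤ k.val + 1 ∧ k.val ≤ l.val + 1 then θ l else 0) ^ n ≤
      3 ^ n * ∑ l : Fin N, if l.val ≤ k.val + 1 ∧ k.val ≤ l.val + 1 then θ l ^ n else 0 := by
  rw [← Finset.sum_filter, ← Finset.sum_filter]
  set S := univ.filter (fun l : Fin N => l.val ≤ k.val + 1 ∧ k.val ≤ l.val + 1) with hS
  have hk : k ∈ S := by simp [hS]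
  have h := pow_sum_le_card_pow_mul_sum_pow (z := θ) ⟨k, hk⟩ (fun l _ => hθ l) n
  refine h.trans (mul_le_mul_of_nonneg_right ?_ (Finset.sum_nonneg fun l _ => pow_nonneg (hθ l) n))
  have h3 : (S.card : ℝ) ≤ 3 := by exact_mod_cast card_filter_nbr_le_three k
  exact pow_le_pow_left₀ (Nat.cast_nonneg _) h3 n

/-- At most `n + 1` sites lie in the ball `{l | l ≤ n}` around the contact site `0`. -/
theorem card_filter_val_le_succ {N : ℕ} (n : ℕ) : (univ.filter fun l : Fin N => l.val ≤ n).card ≤ n + 1 := by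
  calc (univ.filter fun l : Fin N => l.val ≤ n).card ≤ (Finset.range (n + 1)).card := by
        refine Finset.card_le_card_of_injOn Fin.val (fun l hl => ?_) (Set.injOn_of_injective Fin.val_injective)
        simp only [coe_filter, Set.mem_setOf_eq, Finset.mem_univ, true_and] at hl
        simp only [coe_range, Set.mem_Iio]
        omega
    _ = n + 1 := Finset.card_range _

/-- Power mean over the ball around the contact site: `(Σ_{l ≤ n} z_l)² ≤ (n+1)² Σ_{l ≤ n} z_l²` for `z ≥ 0` (`N ≥ 1`). -/
theorem sq_ballSum_le {N : ℕ} (hN : 0 < N) (n : ℕ) {z : Fin N → ℝ} (hz : ∀ l, 0 ≤ z l) :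
    (∑ l : Fin N, if l.val ≤ n then z l else 0) ^ 2 ≤
      ((n : ℝ) + 1) ^ 2 * ∑ l : Fin N, if l.val ≤ n then z l ^ 2 else 0 := by
  rw [← Finset.sum_filter, ← Finset.sum_filter]
  set S := univ.filter (fun l : Fin N => l.val ≤ n) with hS
  have h0 : (⟨0, hN⟩ : Fin N) ∈ S := by simp [hS]
  have h := pow_sum_le_card_pow_mul_sum_pow (z := z) ⟨_, h0⟩ (fun l _ => hz l) 2
  refine h.trans (mul_le_mul_of_nonneg_right ?_ (Finset.sum_nonneg fun l _ => pow_nonneg (hz l) 2))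
  have hc : (S.card : ℝ) ≤ n + 1 := by exact_mod_cast card_filter_val_le_succ (N := N) n
  exact pow_le_pow_left₀ (Nat.cast_nonneg _) hc 2

/-- Sums over the ball `{l | l ≤ n}` of terms bounded by `A`, `ℝ≥0∞` version: `Σ_{l ≤ n} a_l ≤ (n+1) A`. -/
theorem sum_ball_le_ennreal {N : ℕ} (n : ℕ) {a : Fin N → ℝ≥0∞} {A : ℝ≥0∞} (ha : ∀ l : Fin N, l.val ≤ n → a l ≤ A) :
    (∑ l : Fin N, if l.val ≤ n then a l else 0) ≤ ((n : ℝ≥0∞) + 1) * A := by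
  rw [← Finset.sum_filter]
  calc ∑ l ∈ univ.filter (fun l : Fin N => l.val ≤ n), a l ≤ ∑ _l ∈ univ.filter (fun l : Fin N => l.val ≤ n), A :=
        Finset.sum_le_sum fun l hl => ha l (by simpa using hl)
    _ = ((univ.filter fun l : Fin N => l.val ≤ n).card : ℝ≥0∞) * A := by rw [Finset.sum_const, nsmul_eq_mul]
    _ ≤ ((n : ℝ≥0∞) + 1) * A := by
        gcongr
        exact_mod_cast card_filter_val_le_succ (N := N) n

/-- The numerical constant of the site-weight moments: for `C ≥ 1`, `A ≥ 0`, `t ∈ [0,1]`, `k ≥ 1`,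
`5^k (1 + 2·2^k C(Ak)^k + 2(2t²)^k C(Ak)^k) ≤ 5 C (10 A₁ k)^k`, `A₁ = max A 1`. -/
theorem siteWeight_const_le {C A t : ℝ} (hC1 : 1 ≤ C) (hA0 : 0 ≤ A) (ht0 : 0 ≤ t) (ht1 : t ≤ 1) {k : ℕ} (hk : 1 ≤ k) :
    5 ^ k * (1 + 2 * 2 ^ k * (C * (A * k) ^ k) + 2 * (2 * t ^ 2) ^ k * (C * (A * k) ^ k)) ≤
      5 * C * (10 * max A 1 * k) ^ k := by
  set A₁ := max A 1 with hA₁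
  have hA₁1 : 1 ≤ A₁ := le_max_right _ _
  have hAA₁ : A ≤ A₁ := le_max_left _ _
  have hk1 : (1:ℝ) ≤ k := by exact_mod_cast hk
  have hC0 : 0 ≤ C := zero_le_one.trans hC1
  set X : ℝ := C * (A * k) ^ k with hX
  set X₁ : ℝ := C * (A₁ * k) ^ k with hX₁
  have hX0 : 0 ≤ X := by positivity
  have hXX₁ : X ≤ X₁ := mul_le_mul_of_nonneg_left (pow_le_pow_left₀ (by positivity) (by nlinarith) k) hC0
  have hb : (2 * t ^ 2) ^ k ≤ 2 ^ k := pow_le_pow_left₀ (by positivity) (by nlinarith) k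
  have h2k : (1:ℝ) ≤ 2 ^ k := one_le_pow₀ (by norm_num)
  have hX₁1 : 1 ≤ X₁ := by
    have h4 : (1:ℝ) ≤ (A₁ * k) ^ k := one_le_pow₀ (by nlinarith)
    nlinarith
  have hY1 : 1 ≤ 2 ^ k * X₁ := by nlinarith
  have hmid : 1 + 2 * 2 ^ k * X + 2 * (2 * t ^ 2) ^ k * X ≤ 5 * (2 ^ k * X₁) := by
    have h1 : 2 * 2 ^ k * X ≤ 2 * 2 ^ k * X₁ := by gcongr
    have h2 : 2 * (2 * t ^ 2) ^ k * X ≤ 2 * 2 ^ k * X₁ :=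
      mul_le_mul (mul_le_mul_of_nonneg_left hb zero_le_two) hXX₁ hX0 (by positivity)
    linarith
  calc 5 ^ k * (1 + 2 * 2 ^ k * X + 2 * (2 * t ^ 2) ^ k * X) ≤ 5 ^ k * (5 * (2 ^ k * X₁)) :=
        mul_le_mul_of_nonneg_left hmid (by positivity)
    _ = 5 * C * (10 * A₁ * k) ^ k := by
        have h10 : (10:ℝ) ^ k = 5 ^ k * 2 ^ k := by rw [← mul_pow]; norm_num
        rw [show 10 * A₁ * (k:ℝ) = 10 * (A₁ * k) by ring, mul_pow, h10, hX₁]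
        ring

/-! ### Moments of the light-cone weights -/

variable {ω₂ lam β γ : ℝ} (hω : 0 < ω₂) (hl : 0 ≤ lam) (hβ : 0 ≤ β) (hγ : 0 ≤ γ) {T : ℝ} (hT : 0 < T)

include hω hl hβ hγ in
/-- The site weight `θ_m` of the light cone (window `t`, flipped site `i₀`) is jointly measurable in `(x, ω)`. -/
theorem measurable_siteWeight (N : ℕ) (i₀ m : Fin N) (t : ℝ) :
    Measurable fun q : PhaseSpace N × WienerPair =>
      1 + (2 * q.1.1 m ^ 2 + 2 * t * ∫ r in (0:ℝ)..t, ((pinnedChain ω₂ lam β γ).solMap N T T r q.1 (pairPath q.2)).2 m ^ 2) +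
        (2 * q.1.1 m ^ 2 + 2 * t * ∫ r in (0:ℝ)..t,
          ((pinnedChain ω₂ lam β γ).solMap N T T r (momentumFlip i₀ q.1) (pairPath q.2)).2 m ^ 2) := by
  have hIm : Measurable fun q : PhaseSpace N × WienerPair =>
      ∫ r in (0:ℝ)..t, ((pinnedChain ω₂ lam β γ).solMap N T T r q.1 (pairPath q.2)).2 m ^ 2 :=
    pinnedChain_measurable_timeIntegral_momentum_pow hω hl hβ hγ N T T t m 2
  have hΘm : Measurable fun q : PhaseSpace N × WienerPair => (momentumFlip i₀ q.1, q.2) :=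
    ((measurable_momentumFlip i₀).comp measurable_fst).prodMk measurable_snd
  have hI'm : Measurable fun q : PhaseSpace N × WienerPair =>
      ∫ r in (0:ℝ)..t, ((pinnedChain ω₂ lam β γ).solMap N T T r (momentumFlip i₀ q.1) (pairPath q.2)).2 m ^ 2 := by
    have h := hIm.comp hΘm
    exact h
  have hqm : Measurable fun q : PhaseSpace N × WienerPair => q.1.1 m :=
    (measurable_pi_apply m).comp (measurable_fst.comp measurable_fst)
  exact (measurable_const.add (((hqm.pow_const 2).const_mul 2).add (hIm.const_mul _))).add
    (((hqm.pow_const 2).const_mul 2).add (hI'm.const_mul _))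

/-- The site weight is `≥ 1` (hence nonnegative) for `t ≥ 0`. -/
theorem one_le_siteWeight (P : OscillatorChain) (N : ℕ) (T : ℝ) (i₀ m : Fin N) {t : ℝ} (ht0 : 0 ≤ t)
    (q : PhaseSpace N × WienerPair) :
    1 ≤ 1 + (2 * q.1.1 m ^ 2 + 2 * t * ∫ r in (0:ℝ)..t, (P.solMap N T T r q.1 (pairPath q.2)).2 m ^ 2) +
        (2 * q.1.1 m ^ 2 + 2 * t * ∫ r in (0:ℝ)..t, (P.solMap N T T r (momentumFlip i₀ q.1) (pairPath q.2)).2 m ^ 2) := by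
  have h1 : 0 ≤ ∫ r in (0:ℝ)..t, (P.solMap N T T r q.1 (pairPath q.2)).2 m ^ 2 :=
    intervalIntegral.integral_nonneg ht0 fun r _ => sq_nonneg _
  have h2 : 0 ≤ ∫ r in (0:ℝ)..t, (P.solMap N T T r (momentumFlip i₀ q.1) (pairPath q.2)).2 m ^ 2 :=
    intervalIntegral.integral_nonneg ht0 fun r _ => sq_nonneg _
  nlinarith [sq_nonneg (q.1.1 m)]

include hω hl hβ hγ hT in
/-- **Moments of the site weight, factorial growth.**  With the `N`-uniform factorial Gibbs moments of helper 8
(`∫ q_i^{2k}, ∫ p_i^{2k} dμ_T^N ≤ C (A k)^k`): for `N ≥ 1`, `t ∈ [0, 1]` and `k ≥ 1`, `∫⁻ θ_m^k dπ ≤ 5 C (10 A₁ k)^k`,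
`A₁ = max A 1`. -/
theorem lintegral_siteWeight_pow_le_of_moments {C A : ℝ} (hC1 : 1 ≤ C) (hA0 : 0 < A)
    (hmom : ∀ (N : ℕ) (i : Fin N) (k : ℕ),
      Integrable (fun x : PhaseSpace N => x.1 i ^ (2 * k)) ((pinnedChain ω₂ lam β γ).gibbsMeasure N T) ∧
      ∫ x, x.1 i ^ (2 * k) ∂((pinnedChain ω₂ lam β γ).gibbsMeasure N T) ≤ C * (A * k) ^ k ∧
      Integrable (fun x : PhaseSpace N => x.2 i ^ (2 * k)) ((pinnedChain ω₂ lam β γ).gibbsMeasure N T) ∧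
      ∫ x, x.2 i ^ (2 * k) ∂((pinnedChain ω₂ lam β γ).gibbsMeasure N T) ≤ C * (A * k) ^ k)
    {N : ℕ} (hN : 0 < N) (i₀ m : Fin N) {t : ℝ} (ht0 : 0 ≤ t) (ht1 : t ≤ 1) {k : ℕ} (hk : 1 ≤ k) :
    ∫⁻ q, ENNReal.ofReal ((1 + (2 * q.1.1 m ^ 2 + 2 * t * ∫ r in (0:ℝ)..t,
        ((pinnedChain ω₂ lam β γ).solMap N T T r q.1 (pairPath q.2)).2 m ^ 2) +
        (2 * q.1.1 m ^ 2 + 2 * t * ∫ r in (0:ℝ)..t,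
          ((pinnedChain ω₂ lam β γ).solMap N T T r (momentumFlip i₀ q.1) (pairPath q.2)).2 m ^ 2)) ^ k)
        ∂(((pinnedChain ω₂ lam β γ).gibbsMeasure N T).prod wienerPair) ≤
      ENNReal.ofReal (5 * C * (10 * max A 1 * k) ^ k) := by
  obtain ⟨hq, hq', hp, hp'⟩ := hmom N m k
  have h := lintegral_siteWeight_pow_le hω hl hβ hγ N hN hT i₀ m ht0 hk ⟨hq, hq'⟩ ⟨hp, hp'⟩
  exact h.trans (ENNReal.ofReal_le_ofReal (siteWeight_const_le hC1 hA0.le ht0 ht1 hk))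

include hω hl hβ hγ hT in
/-- **Moments of the local weight.**  For `N ≥ 1`, `t ∈ [0,1]`, `k ≥ 1` and every site `l`:
`∫⁻ Θ_l^k dπ ≤ 15 C (30 A₁ k)^k` for `Θ_l = Σ_{|m−l|≤1} θ_m` (power mean over the at most three neighbours). -/
theorem lintegral_localWeight_pow_le {C A : ℝ} (hC1 : 1 ≤ C) (hA0 : 0 < A)
    (hmom : ∀ (N : ℕ) (i : Fin N) (k : ℕ),
      Integrable (fun x : PhaseSpace N => x.1 i ^ (2 * k)) ((pinnedChain ω₂ lam β γ).gibbsMeasure N T) ∧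
      ∫ x, x.1 i ^ (2 * k) ∂((pinnedChain ω₂ lam β γ).gibbsMeasure N T) ≤ C * (A * k) ^ k ∧
      Integrable (fun x : PhaseSpace N => x.2 i ^ (2 * k)) ((pinnedChain ω₂ lam β γ).gibbsMeasure N T) ∧
      ∫ x, x.2 i ^ (2 * k) ∂((pinnedChain ω₂ lam β γ).gibbsMeasure N T) ≤ C * (A * k) ^ k)
    {N : ℕ} (hN : 0 < N) (i₀ l : Fin N) {t : ℝ} (ht0 : 0 ≤ t) (ht1 : t ≤ 1) {k : ℕ} (hk : 1 ≤ k) :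
    ∫⁻ q, ENNReal.ofReal ((∑ m : Fin N, if m.val ≤ l.val + 1 ∧ l.val ≤ m.val + 1 then
        (1 + (2 * q.1.1 m ^ 2 + 2 * t * ∫ r in (0:ℝ)..t,
          ((pinnedChain ω₂ lam β γ).solMap N T T r q.1 (pairPath q.2)).2 m ^ 2) +
          (2 * q.1.1 m ^ 2 + 2 * t * ∫ r in (0:ℝ)..t,
            ((pinnedChain ω₂ lam β γ).solMap N T T r (momentumFlip i₀ q.1) (pairPath q.2)).2 m ^ 2)) else 0) ^ k)
        ∂(((pinnedChain ω₂ lam β γ).gibbsMeasure N T).prod wienerPair) ≤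
      ENNReal.ofReal (15 * C * (30 * max A 1 * k) ^ k) := by
  set P := pinnedChain ω₂ lam β γ with hP
  set π : Measure (PhaseSpace N × WienerPair) := (P.gibbsMeasure N T).prod wienerPair with hπ
  set θ : Fin N → PhaseSpace N × WienerPair → ℝ := fun m q =>
    1 + (2 * q.1.1 m ^ 2 + 2 * t * ∫ r in (0:ℝ)..t, (P.solMap N T T r q.1 (pairPath q.2)).2 m ^ 2) +
      (2 * q.1.1 m ^ 2 + 2 * t * ∫ r in (0:ℝ)..t, (P.solMap N T T r (momentumFlip i₀ q.1) (pairPath q.2)).2 m ^ 2) with hθ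
  have hθ0 : ∀ m q, 0 ≤ θ m q := fun m q => zero_le_one.trans (one_le_siteWeight P N T i₀ m ht0 q)
  have hθm : ∀ m, Measurable (θ m) := fun m => measurable_siteWeight hω hl hβ hγ (T := T) N i₀ m t
  set B : ℝ := 5 * C * (10 * max A 1 * k) ^ k with hB
  have hB0 : 0 ≤ B := by positivity
  have hθk : ∀ m, ∫⁻ q, ENNReal.ofReal (θ m q ^ k) ∂π ≤ ENNReal.ofReal B := fun m =>
    lintegral_siteWeight_pow_le_of_moments hω hl hβ hγ hT hC1 hA0 hmom hN i₀ m ht0 ht1 hk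
  -- pointwise power mean, in `ℝ≥0∞`
  have hpt : ∀ q, ENNReal.ofReal ((∑ m : Fin N, if m.val ≤ l.val + 1 ∧ l.val ≤ m.val + 1 then θ m q else 0) ^ k) ≤
      ENNReal.ofReal (3 ^ k) * ∑ m : Fin N,
        (if m.val ≤ l.val + 1 ∧ l.val ≤ m.val + 1 then ENNReal.ofReal (θ m q ^ k) else 0) := by
    intro q
    calc ENNReal.ofReal ((∑ m : Fin N, if m.val ≤ l.val + 1 ∧ l.val ≤ m.val + 1 then θ m q else 0) ^ k)
        ≤ ENNReal.ofReal (3 ^ k * ∑ m : Fin N, if m.val ≤ l.val + 1 ∧ l.val ≤ m.val + 1 then θ m q ^ k else 0) :=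
          ENNReal.ofReal_le_ofReal (pow_nbrSum_le l (fun m => hθ0 m q) k)
      _ = ENNReal.ofReal (3 ^ k) * ENNReal.ofReal (∑ m : Fin N, if m.val ≤ l.val + 1 ∧ l.val ≤ m.val + 1 then θ m q ^ k else 0) :=
          ENNReal.ofReal_mul (by positivity)
      _ = ENNReal.ofReal (3 ^ k) * ∑ m : Fin N,
            (if m.val ≤ l.val + 1 ∧ l.val ≤ m.val + 1 then ENNReal.ofReal (θ m q ^ k) else 0) := by
          congr 1
          rw [ENNReal.ofReal_sum_of_nonneg (fun m _ => ?_)]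
          · refine Finset.sum_congr rfl fun m _ => ?_
            split_ifs <;> simp
          · split_ifs <;> [exact pow_nonneg (hθ0 m q) k; exact le_rfl]
  -- integrate
  have hmi : ∀ m, Measurable fun q => (if m.val ≤ l.val + 1 ∧ l.val ≤ m.val + 1 then ENNReal.ofReal (θ m q ^ k) else 0) :=
    fun m => by
      split_ifs <;> [exact ((hθm m).pow_const k).ennreal_ofReal; exact measurable_const]
  have hsm : Measurable fun q => ∑ m : Fin N,
      (if m.val ≤ l.val + 1 ∧ l.val ≤ m.val + 1 then ENNReal.ofReal (θ m q ^ k) else 0) :=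
    Finset.measurable_sum _ fun m _ => hmi m
  calc ∫⁻ q, ENNReal.ofReal ((∑ m : Fin N, if m.val ≤ l.val + 1 ∧ l.val ≤ m.val + 1 then θ m q else 0) ^ k) ∂π
      ≤ ∫⁻ q, ENNReal.ofReal (3 ^ k) * ∑ m : Fin N,
          (if m.val ≤ l.val + 1 ∧ l.val ≤ m.val + 1 then ENNReal.ofReal (θ m q ^ k) else 0) ∂π := lintegral_mono hpt
    _ = ENNReal.ofReal (3 ^ k) * ∑ m : Fin N,
          (if m.val ≤ l.val + 1 ∧ l.val ≤ m.val + 1 then ∫⁻ q, ENNReal.ofReal (θ m q ^ k) ∂π else 0) := by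
        rw [lintegral_const_mul _ hsm, lintegral_finsetSum _ fun m _ => hmi m]
        congr 1
        refine Finset.sum_congr rfl fun m _ => ?_
        split_ifs <;> simp
    _ ≤ ENNReal.ofReal (3 ^ k) * (3 * ENNReal.ofReal B) := by
        gcongr
        exact sum_nbr_le_ennreal l fun m _ => hθk m
    _ = ENNReal.ofReal (15 * C * (30 * max A 1 * k) ^ k) := by
        rw [← ENNReal.ofReal_ofNat 3, ← ENNReal.ofReal_mul (by norm_num), ← ENNReal.ofReal_mul (by positivity), hB]
        congr 1
        rw [show (30:ℝ) * max A 1 * k = 3 * (10 * max A 1 * k) by ring, mul_pow (3:ℝ)]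
        ring

include hω hl hβ hγ hT in
/-- **Second moments of the local light-cone sums.**  For `N ≥ 1`, `t ∈ [0, 1]`, `C₁ ≥ 0` and `n ≥ 1`, with the local weights
`Θ_l` around the contact site `i₀ = 0`:  `∫⁻ (Σ_{l ≤ n} (C₁ Θ_l)^n)² dπ ≤ 15 C ((n+1)² (60 C₁ A₁ n)^n)²`. -/
theorem lintegral_coneSum_sq_le {C A : ℝ} (hC1 : 1 ≤ C) (hA0 : 0 < A)
    (hmom : ∀ (N : ℕ) (i : Fin N) (k : ℕ),
      Integrable (fun x : PhaseSpace N => x.1 i ^ (2 * k)) ((pinnedChain ω₂ lam β γ).gibbsMeasure N T) ∧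
      ∫ x, x.1 i ^ (2 * k) ∂((pinnedChain ω₂ lam β γ).gibbsMeasure N T) ≤ C * (A * k) ^ k ∧
      Integrable (fun x : PhaseSpace N => x.2 i ^ (2 * k)) ((pinnedChain ω₂ lam β γ).gibbsMeasure N T) ∧
      ∫ x, x.2 i ^ (2 * k) ∂((pinnedChain ω₂ lam β γ).gibbsMeasure N T) ≤ C * (A * k) ^ k)
    {N : ℕ} (hN : 0 < N) {t : ℝ} (ht0 : 0 ≤ t) (ht1 : t ≤ 1) {C₁ : ℝ} (hC₁ : 0 ≤ C₁) {n : ℕ} (hn : 1 ≤ n) :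
    ∫⁻ q, ENNReal.ofReal ((∑ l : Fin N, if l.val ≤ n then
        (C₁ * ∑ m : Fin N, if m.val ≤ l.val + 1 ∧ l.val ≤ m.val + 1 then
          (1 + (2 * q.1.1 m ^ 2 + 2 * t * ∫ r in (0:ℝ)..t,
            ((pinnedChain ω₂ lam β γ).solMap N T T r q.1 (pairPath q.2)).2 m ^ 2) +
            (2 * q.1.1 m ^ 2 + 2 * t * ∫ r in (0:ℝ)..t,
              ((pinnedChain ω₂ lam β γ).solMap N T T r (momentumFlip ⟨0, hN⟩ q.1) (pairPath q.2)).2 m ^ 2)) else 0) ^ n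
        else 0) ^ 2)
        ∂(((pinnedChain ω₂ lam β γ).gibbsMeasure N T).prod wienerPair) ≤
      ENNReal.ofReal (15 * C * ((((n : ℝ) + 1) ^ 2 * (60 * C₁ * max A 1 * n) ^ n) ^ 2)) := by
  set P := pinnedChain ω₂ lam β γ with hP
  set π : Measure (PhaseSpace N × WienerPair) := (P.gibbsMeasure N T).prod wienerPair with hπ
  set i₀ : Fin N := ⟨0, hN⟩ with hi₀
  set θ : Fin N → PhaseSpace N × WienerPair → ℝ := fun m q =>
    1 + (2 * q.1.1 m ^ 2 + 2 * t * ∫ r in (0:ℝ)..t, (P.solMap N T T r q.1 (pairPath q.2)).2 m ^ 2) +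
      (2 * q.1.1 m ^ 2 + 2 * t * ∫ r in (0:ℝ)..t, (P.solMap N T T r (momentumFlip i₀ q.1) (pairPath q.2)).2 m ^ 2) with hθ
  set Θ : Fin N → PhaseSpace N × WienerPair → ℝ := fun l q =>
    ∑ m : Fin N, if m.val ≤ l.val + 1 ∧ l.val ≤ m.val + 1 then θ m q else 0 with hΘ
  have hθ0 : ∀ m q, 0 ≤ θ m q := fun m q => zero_le_one.trans (one_le_siteWeight P N T i₀ m ht0 q)
  have hθm : ∀ m, Measurable (θ m) := fun m => measurable_siteWeight hω hl hβ hγ (T := T) N i₀ m t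
  have hΘ0 : ∀ l q, 0 ≤ Θ l q := fun l q => Finset.sum_nonneg fun m _ => by
    split_ifs <;> [exact hθ0 m q; exact le_rfl]
  have hΘm : ∀ l, Measurable (Θ l) := fun l =>
    Finset.measurable_sum _ fun m _ => by split_ifs <;> [exact hθm m; exact measurable_const]
  have h2n : 1 ≤ 2 * n := by omega
  set B : ℝ := 15 * C * (30 * max A 1 * (2 * n : ℕ)) ^ (2 * n) with hB
  have hB0 : 0 ≤ B := by positivity
  have hΘk : ∀ l, ∫⁻ q, ENNReal.ofReal (Θ l q ^ (2 * n)) ∂π ≤ ENNReal.ofReal B := fun l =>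
    lintegral_localWeight_pow_le hω hl hβ hγ hT hC1 hA0 hmom hN i₀ l ht0 ht1 h2n
  -- pointwise power mean over the ball, in `ℝ≥0∞`
  have hz0 : ∀ l q, 0 ≤ (C₁ * Θ l q) ^ n := fun l q => pow_nonneg (mul_nonneg hC₁ (hΘ0 l q)) n
  have hpt : ∀ q, ENNReal.ofReal ((∑ l : Fin N, if l.val ≤ n then (C₁ * Θ l q) ^ n else 0) ^ 2) ≤
      ENNReal.ofReal (((n : ℝ) + 1) ^ 2 * C₁ ^ (2 * n)) *
        ∑ l : Fin N, (if l.val ≤ n then ENNReal.ofReal (Θ l q ^ (2 * n)) else 0) := by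
    intro q
    have h1 := sq_ballSum_le hN n (z := fun l => (C₁ * Θ l q) ^ n) (fun l => hz0 l q)
    have e : ∀ l, ((C₁ * Θ l q) ^ n) ^ 2 = C₁ ^ (2 * n) * Θ l q ^ (2 * n) := fun l => by
      rw [← pow_mul, mul_pow, mul_comm n 2]
    simp only [e] at h1
    calc ENNReal.ofReal ((∑ l : Fin N, if l.val ≤ n then (C₁ * Θ l q) ^ n else 0) ^ 2)
        ≤ ENNReal.ofReal (((n : ℝ) + 1) ^ 2 * ∑ l : Fin N, if l.val ≤ n then C₁ ^ (2 * n) * Θ l q ^ (2 * n) else 0) :=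
          ENNReal.ofReal_le_ofReal h1
      _ = ENNReal.ofReal (((n : ℝ) + 1) ^ 2 * C₁ ^ (2 * n) * ∑ l : Fin N, if l.val ≤ n then Θ l q ^ (2 * n) else 0) := by
          congr 1
          have hms : (∑ l : Fin N, if l.val ≤ n then C₁ ^ (2 * n) * Θ l q ^ (2 * n) else 0) =
              C₁ ^ (2 * n) * ∑ l : Fin N, if l.val ≤ n then Θ l q ^ (2 * n) else 0 := by
            rw [Finset.mul_sum]
            refine Finset.sum_congr rfl fun l _ => ?_
            split_ifs <;> simp
          rw [hms, mul_assoc]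
      _ = ENNReal.ofReal (((n : ℝ) + 1) ^ 2 * C₁ ^ (2 * n)) *
            ENNReal.ofReal (∑ l : Fin N, if l.val ≤ n then Θ l q ^ (2 * n) else 0) := ENNReal.ofReal_mul (by positivity)
      _ = _ := by
          congr 1
          rw [ENNReal.ofReal_sum_of_nonneg (fun l _ => ?_)]
          · refine Finset.sum_congr rfl fun l _ => ?_
            split_ifs <;> simp
          · split_ifs <;> [exact pow_nonneg (hΘ0 l q) _; exact le_rfl]
  have hmi : ∀ l, Measurable fun q => (if l.val ≤ n then ENNReal.ofReal (Θ l q ^ (2 * n)) else 0) := fun l => by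
    split_ifs <;> [exact ((hΘm l).pow_const _).ennreal_ofReal; exact measurable_const]
  have hsm : Measurable fun q => ∑ l : Fin N, (if l.val ≤ n then ENNReal.ofReal (Θ l q ^ (2 * n)) else 0) :=
    Finset.measurable_sum _ fun l _ => hmi l
  have hcast : ((2 * n : ℕ) : ℝ) = 2 * n := by push_cast; ring
  calc ∫⁻ q, ENNReal.ofReal ((∑ l : Fin N, if l.val ≤ n then (C₁ * Θ l q) ^ n else 0) ^ 2) ∂π
      ≤ ∫⁻ q, ENNReal.ofReal (((n : ℝ) + 1) ^ 2 * C₁ ^ (2 * n)) *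
          ∑ l : Fin N, (if l.val ≤ n then ENNReal.ofReal (Θ l q ^ (2 * n)) else 0) ∂π := lintegral_mono hpt
    _ = ENNReal.ofReal (((n : ℝ) + 1) ^ 2 * C₁ ^ (2 * n)) *
          ∑ l : Fin N, (if l.val ≤ n then ∫⁻ q, ENNReal.ofReal (Θ l q ^ (2 * n)) ∂π else 0) := by
        rw [lintegral_const_mul _ hsm, lintegral_finsetSum _ fun l _ => hmi l]
        congr 1
        refine Finset.sum_congr rfl fun l _ => ?_
        split_ifs <;> simp
    _ ≤ ENNReal.ofReal (((n : ℝ) + 1) ^ 2 * C₁ ^ (2 * n)) * (((n : ℝ≥0∞) + 1) * ENNReal.ofReal B) := by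
        gcongr
        exact sum_ball_le_ennreal n fun l _ => hΘk l
    _ = ENNReal.ofReal (((n : ℝ) + 1) ^ 2 * C₁ ^ (2 * n) * (((n : ℝ) + 1) * B)) := by
        have e1 : ((n : ℝ≥0∞) + 1) = ENNReal.ofReal ((n : ℝ) + 1) := by
          rw [ENNReal.ofReal_add (Nat.cast_nonneg n) zero_le_one, ENNReal.ofReal_natCast, ENNReal.ofReal_one]
        rw [e1, ← ENNReal.ofReal_mul (by positivity), ← ENNReal.ofReal_mul (by positivity)]
    _ ≤ ENNReal.ofReal (15 * C * ((((n : ℝ) + 1) ^ 2 * (60 * C₁ * max A 1 * n) ^ n) ^ 2)) := by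
        refine ENNReal.ofReal_le_ofReal ?_
        rw [hB, hcast]
        have hn0 : (0 : ℝ) ≤ n := Nat.cast_nonneg n
        have hA₁ : 0 ≤ max A 1 := le_trans zero_le_one (le_max_right _ _)
        have epow : (30 * max A 1 * (2 * (n : ℝ))) ^ (2 * n) = ((60 * max A 1 * n) ^ n) ^ 2 := by
          rw [← pow_mul, mul_comm n 2]; ring_nf
        have eC : C₁ ^ (2 * n) = (C₁ ^ n) ^ 2 := by rw [← pow_mul, mul_comm]
        rw [epow, eC]
        have hcube : ((n : ℝ) + 1) ^ 3 ≤ ((n : ℝ) + 1) ^ 4 :=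
          pow_le_pow_right₀ (by linarith) (by norm_num)
        have hX : 0 ≤ 15 * C * ((C₁ ^ n) ^ 2 * ((60 * max A 1 * n) ^ n) ^ 2) := by positivity
        calc ((n : ℝ) + 1) ^ 2 * (C₁ ^ n) ^ 2 * (((n : ℝ) + 1) * (15 * C * ((60 * max A 1 * ↑n) ^ n) ^ 2))
            = ((n : ℝ) + 1) ^ 3 * (15 * C * ((C₁ ^ n) ^ 2 * ((60 * max A 1 * n) ^ n) ^ 2)) := by ring
          _ ≤ ((n : ℝ) + 1) ^ 4 * (15 * C * ((C₁ ^ n) ^ 2 * ((60 * max A 1 * n) ^ n) ^ 2)) :=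
              mul_le_mul_of_nonneg_right hcube hX
          _ = 15 * C * ((((n : ℝ) + 1) ^ 2 * (60 * C₁ * max A 1 * n) ^ n) ^ 2) := by ring

/-- **Registered helper `helper_kdConeSumMoments` (stub S, line `kick-dipole-no-collapse`): SECOND MOMENTS OF THE LOCAL
LIGHT-CONE SUMS UNDER GIBBS ⊗ WIENER.**  For the pinned chain (`ω₂ > 0`, `lam, β, γ ≥ 0`) and `T > 0` there are `C ≥ 1`,
`A₁ ≥ 1` (from the factorial Gibbs moments of helper 8) such that for every `N ≥ 1`, window `t ∈ [0,1]`, constant `C₁ ≥ 0` and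
order `n ≥ 1`:  `∫⁻ (Σ_{l ≤ n} (C₁ Θ_l)^n)² d(μ_T ⊗ W) ≤ 15 C ((n+1)² (60 C₁ A₁ n)^n)²`, with the local weights `Θ_l` of the
light cone from the contact site `0`. -/
theorem helper_kdConeSumMoments : ∀ ω₂ lam β γ : ℝ, 0 < ω₂ → 0 ≤ lam → 0 ≤ β → 0 ≤ γ → ∀ T : ℝ, 0 < T → ∃ C A₁ : ℝ, 1 ≤ C ∧ 1 ≤ A₁ ∧ ∀ (N : ℕ) (hN : 0 < N) (t : ℝ), 0 ≤ t → t ≤ 1 → ∀ (C₁ : ℝ), 0 ≤ C₁ → ∀ (n : ℕ), 1 ≤ n → ∫⁻ q, ENNReal.ofReal ((∑ l : Fin N, if l.val ≤ n then (C₁ * ∑ m : Fin N, if m.val ≤ l.val + 1 ∧ l.val ≤ m.val + 1 then (1 + (2 * q.1.1 m ^ 2 + 2 * t * ∫ r in (0:ℝ)..t, ((pinnedChain ω₂ lam β γ).solMap N T T r q.1 (pairPath q.2)).2 m ^ 2) + (2 * q.1.1 m ^ 2 + 2 * t * ∫ r in (0:ℝ)..t, ((pinnedChain ω₂ lam β γ).solMap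 N T T r (momentumFlip ⟨0, hN⟩ q.1) (pairPath q.2)).2 m ^ 2)) else 0) ^ n else 0) ^ 2) ∂(((pinnedChain ω₂ lam β γ).gibbsMeasure N T).prod wienerPair) ≤ ENNReal.ofReal (15 * C * ((((n : ℝ) + 1) ^ 2 * (60 * C₁ * A₁ * n) ^ n) ^ 2)) := by
  intro ω₂ lam β γ hω hl hβ hγ T hT
  obtain ⟨C, A, hC1, hA0, hmom⟩ := helper_kdGibbsFactorialMoments ω₂ lam β γ hω hl hβ T hT
  refine ⟨C, max A 1, hC1, le_max_right _ _, fun N hN t ht0 ht1 C₁ hC₁ n hn => ?_⟩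
  exact lintegral_coneSum_sq_le hω hl hβ hγ hT hC1 hA0 hmom hN ht0 ht1 hC₁ hn

end Summit.AtomisticToContinuum.FouriersLaw.Cruxes.ConductanceLowerBound.KickDipoleNoCollapse

end
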